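import Literature.Probability.Process.CharacterTotal
import Literature.Probability.Distributions.GaussianL2Limit
import Mathlib.Probability.Distributions.Gaussian.IsGaussianProcess.Basic
import Mathlib.Probability.Distributions.Gaussian.IsGaussianProcess.Independence
import Mathlib.Probability.Independence.Integration
import Mathlib.MeasureTheory.Function.ConditionalExpectation.AEMeasurable
import HarnessLib

/-!
# The Gaussian Hilbert space of a centred Gaussian linear process

A *Gaussian linear process* (random linear functional) is a linear map `X : V →ₗ[ℝ] (Ω → ℝ)` from
a real vector space of "test vectors" to real random variables on a probability space, all finite
families `(X v₁, …, X vₙ)` being jointly Gaussian and centred (`IsGaussianLinearProcess`).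
Examples: a centred Gaussian random field `ω ↦ ω(u)` on `𝒮'(ℝᵈ)` indexed by test functions, the
isonormal process, white noise.  Following S. Janson, *Gaussian Hilbert Spaces* (CUP 1997), Ch. 1,
and Yu. A. Rozanov, *Markov Random Fields* (Springer 1982), Ch. 2 §3.1, we set up

* `toL2` — the linear map `v ↦ X v ∈ L²(μ)`, with `⟪X u, X v⟫ = E[X u · X v]`;
* `space I` — the closed linear span `H(I) ⊆ L²(μ)` of `{X v : v ∈ I}` for a submodule `I ≤ V`
  (Rozanov's `H(S)`), and the facts: its elements are centred (`integral_eq_zero_of_mem_space`),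
  a.e.-measurable for `σ(X v : v ∈ I)` (`aestronglyMeasurable_of_mem_space`), jointly Gaussian
  (`isGaussianProcess_space`: the closure of a Gaussian linear space in `L²` is Gaussian, Janson
  Ch. 1), and
* `indep_comap_of_forall_inner_eq_zero` — an element of the Gaussian space orthogonal to all
  `X v`, `v ∈ I`, is INDEPENDENT of the σ-algebra `σ(X v : v ∈ I)` (jointly Gaussian and
  uncorrelated; Rozanov Ch. 2 §3.1: "conditional distributions … are Gaussian with conditional
  expectations `P(H)η`").

These are the ingredients of "conditional expectation given `σ(H(S))` = orthogonal projection onto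
`H(S)`" for Gaussian fields and of the germ σ-algebra computations in
`Literature/Probability/Process/GaussianGermIndep.lean`.

Mathlib: `IsGaussianProcess`, `HasGaussianLaw`, `IsGaussianProcess.indepFun_of_covariance_eq_zero`,
`MemLp.toLp`, `lpMeas`/`isClosed_aestronglyMeasurable`; tree: `hasGaussianLaw_pi_of_tendsto_eLpNorm`
(`GaussianL2Limit`), `generatedSigma` (`CharacterTotal`).  Verified absent at the pin: any Gaussian
Hilbert space / closed-span construction for Gaussian processes.
-/

noncomputable section

open MeasureTheory ProbabilityTheory Filter
open scoped ENNReal InnerProductSpace Topology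

namespace Literature.Probability.Process

variable {Ω : Type*} {m₀ : MeasurableSpace Ω} {μ : Measure Ω}
variable {V : Type*} [AddCommGroup V] [Module ℝ V]

/-- A **centred Gaussian linear process** (Gaussian random linear functional): a linear map
`X : V →ₗ[ℝ] (Ω → ℝ)` with measurable values whose finite-dimensional marginals are Gaussian
(Mathlib's `IsGaussianProcess`) and centred.  Janson 1997, Ch. 1 (Gaussian linear spaces;
Gaussian fields indexed by a linear space); Rozanov 1982, Ch. 2 §3.1 ("generalized Gaussian
function `(u, ξ)`"). [cite: Janson1997, Ch. 1, Def. 1.2] -/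
structure IsGaussianLinearProcess (X : V →ₗ[ℝ] Ω → ℝ) (μ : Measure Ω) : Prop where
  /-- every value is measurable -/
  measurable : ∀ v, Measurable (X v)
  /-- finite-dimensional marginals are Gaussian -/
  isGaussianProcess : IsGaussianProcess X μ
  /-- the process is centred -/
  centered : ∀ v, ∫ ω, X v ω ∂μ = 0

namespace IsGaussianLinearProcess

variable {X : V →ₗ[ℝ] Ω → ℝ} (h : IsGaussianLinearProcess X μ)
include h

/-- The underlying measure is a probability measure. [folklore] -/
theorem isProbabilityMeasure : IsProbabilityMeasure μ := h.isGaussianProcess.isProbabilityMeasure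

/-- Every value is square integrable. [folklore] -/
theorem memLp (v : V) : MemLp (X v) 2 μ := (h.isGaussianProcess.hasGaussianLaw_eval v).memLp_two

/-! ### The embedding into `L²` and the Gaussian space -/

/-- The linear map `v ↦ X v ∈ L²(μ)` (Rozanov's operator `J`, Ch. 3 §1.1 (1.1)). [folklore] -/
def toL2 : V →ₗ[ℝ] Lp ℝ 2 μ where
  toFun v := (h.memLp v).toLp (X v)
  map_add' u v := by
    rw [← MemLp.toLp_add (h.memLp u) (h.memLp v)]
    exact MemLp.toLp_congr _ _ (by rw [map_add])
  map_smul' c v := by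
    rw [RingHom.id_apply, ← MemLp.toLp_const_smul c (h.memLp v)]
    exact MemLp.toLp_congr _ _ (by rw [map_smul])

/-- `toL2 v = X v` almost everywhere. [folklore] -/
theorem coeFn_toL2 (v : V) : (h.toL2 v : Ω → ℝ) =ᵐ[μ] X v := (h.memLp v).coeFn_toLp

/-- `⟪X u, X v⟫_{L²} = E[X u · X v]`. [folklore] -/
theorem inner_toL2 (u v : V) : ⟪h.toL2 u, h.toL2 v⟫_ℝ = ∫ ω, X u ω * X v ω ∂μ := by
  rw [MeasureTheory.L2.inner_def]
  refine integral_congr_ae ?_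
  filter_upwards [h.coeFn_toL2 u, h.coeFn_toL2 v] with ω hu hv
  rw [hu, hv, RCLike.inner_apply, conj_trivial, mul_comm]

/-- The **Gaussian space** `H(I)` of a submodule `I ≤ V` of test vectors: the closed linear span in
`L²(μ)` of `{X v : v ∈ I}` (Rozanov's `H(S)`, Ch. 2 §3.1; Janson's Gaussian Hilbert space for
`I = ⊤`). [cite: Rozanov1982, Ch. 2 §3.1] -/
def space (I : Submodule ℝ V) : Submodule ℝ (Lp ℝ 2 μ) := (I.map h.toL2).topologicalClosure

/-- `X v ∈ H(I)` for `v ∈ I`. [folklore] -/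
theorem toL2_mem_space {I : Submodule ℝ V} {v : V} (hv : v ∈ I) : h.toL2 v ∈ h.space I :=
  (I.map h.toL2).le_topologicalClosure (Submodule.mem_map_of_mem hv)

/-- `H(I)` is monotone in `I`. [folklore] -/
theorem space_mono {I J : Submodule ℝ V} (hIJ : I ≤ J) : h.space I ≤ h.space J :=
  Submodule.topologicalClosure_mono (Submodule.map_mono hIJ)

/-- `H(I)` is closed. [folklore] -/
theorem isClosed_space (I : Submodule ℝ V) : IsClosed (h.space I : Set (Lp ℝ 2 μ)) :=
  Submodule.isClosed_topologicalClosure _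

/-- `H(I)` is complete, hence admits an orthogonal projection. [folklore] -/
instance completeSpace_space (I : Submodule ℝ V) : CompleteSpace (h.space I) :=
  (h.isClosed_space I).completeSpace_coe

/-- Elements of `H(I)` are limits of sequences `X vₙ`, `vₙ ∈ I`. [folklore] -/
theorem exists_seq_tendsto_of_mem_space {I : Submodule ℝ V} {x : Lp ℝ 2 μ} (hx : x ∈ h.space I) :
    ∃ v : ℕ → V, (∀ n, v n ∈ I) ∧ Tendsto (fun n => h.toL2 (v n)) atTop (𝓝 x) := by
  have hx' : x ∈ closure ((I.map h.toL2 : Submodule ℝ (Lp ℝ 2 μ)) : Set (Lp ℝ 2 μ)) := by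
    rw [← Submodule.topologicalClosure_coe]; exact hx
  obtain ⟨y, hy, hlim⟩ := mem_closure_iff_seq_limit.1 hx'
  have hy' : ∀ n, ∃ v ∈ I, h.toL2 v = y n := fun n => Submodule.mem_map.1 (hy n)
  choose v hvI hv using hy'
  exact ⟨v, hvI, by simpa [hv] using hlim⟩

/-! ### Elements of the Gaussian space are centred and measurable for `σ(X v : v ∈ I)` -/

/-- Every element of a Gaussian space is centred: `E[x] = 0` for `x ∈ H(I)`. [folklore] -/
theorem integral_eq_zero_of_mem_space {I : Submodule ℝ V} {x : Lp ℝ 2 μ} (hx : x ∈ h.space I) :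
    ∫ ω, x ω ∂μ = 0 := by
  haveI := h.isProbabilityMeasure
  set one : Lp ℝ 2 μ := indicatorConstLp 2 MeasurableSet.univ (measure_ne_top μ _) (1 : ℝ)
  set ℓ : Lp ℝ 2 μ →L[ℝ] ℝ := innerSL ℝ one
  have hℓ : ∀ y : Lp ℝ 2 μ, ℓ y = ∫ ω, y ω ∂μ := fun y => by
    simp only [ℓ, one, innerSL_apply_apply, MeasureTheory.L2.inner_indicatorConstLp_one,
      Measure.restrict_univ]
  have hle : I.map h.toL2 ≤ LinearMap.ker ℓ.toLinearMap := by
    rintro _ ⟨v, -, rfl⟩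
    rw [LinearMap.mem_ker, ContinuousLinearMap.coe_coe, hℓ, integral_congr_ae (h.coeFn_toL2 v)]
    exact h.centered v
  have hmem := Submodule.topologicalClosure_minimal _ hle (ℓ.isClosed_ker) hx
  rw [LinearMap.mem_ker, ContinuousLinearMap.coe_coe, hℓ] at hmem
  exact hmem

/-- The σ-algebra `σ(X v : v ∈ I)` generated by the values on a submodule. [folklore] -/
@[reducible] def sigma (I : Submodule ℝ V) : MeasurableSpace Ω := generatedSigma fun v : I => X v

omit h in
/-- `σ(X v : v ∈ I)` is a sub-σ-algebra of the ambient one. [folklore] -/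
theorem sigma_le (hm : ∀ v, Measurable (X v)) (I : Submodule ℝ V) :
    IsGaussianLinearProcess.sigma (X := X) I ≤ m₀ :=
  generatedSigma_le fun v => hm v

omit h in
/-- `σ(X v : v ∈ I)` is monotone in `I`. [folklore] -/
theorem sigma_mono {I J : Submodule ℝ V} (hIJ : I ≤ J) :
    IsGaussianLinearProcess.sigma (X := X) I ≤ IsGaussianLinearProcess.sigma (X := X) J :=
  iSup_le fun v => le_iSup (fun w : J => MeasurableSpace.comap (X w) inferInstance) ⟨v, hIJ v.2⟩

/-- Every element of `H(I)` is a.e. equal to a `σ(X v : v ∈ I)`-measurable function. [folklore] -/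
theorem aestronglyMeasurable_of_mem_space {I : Submodule ℝ V} {x : Lp ℝ 2 μ} (hx : x ∈ h.space I) :
    AEStronglyMeasurable[IsGaussianLinearProcess.sigma (X := X) I] x μ := by
  have hm : IsGaussianLinearProcess.sigma (X := X) I ≤ m₀ := sigma_le h.measurable I
  have hle : I.map h.toL2 ≤ lpMeas ℝ ℝ (IsGaussianLinearProcess.sigma (X := X) I) 2 μ := by
    rintro _ ⟨v, hv, rfl⟩
    rw [mem_lpMeas_iff_aestronglyMeasurable]
    have hsm : StronglyMeasurable[IsGaussianLinearProcess.sigma (X := X) I] (X v) :=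
      (measurable_generatedSigma (fun w : I => X w) ⟨v, hv⟩).stronglyMeasurable
    exact hsm.aestronglyMeasurable.congr (h.coeFn_toL2 v).symm
  exact (mem_lpMeas_iff_aestronglyMeasurable.1
    (Submodule.topologicalClosure_minimal _ hle (isClosed_aestronglyMeasurable hm) hx))

/-! ### The Gaussian space is jointly Gaussian -/

/-- **The closed linear span of a Gaussian linear process is Gaussian**: the process indexed by
the Gaussian space `H(I)`, `x ↦ (ω ↦ x ω)`, has Gaussian finite-dimensional marginals (Janson 1997,
Ch. 1: the `L²`-closure of a Gaussian linear space is a Gaussian linear space).  Proof: every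
`x ∈ H(I)` is an `L²`-limit of values `X vₙ`; finite families of such are limits of Gaussian
vectors, hence Gaussian (`hasGaussianLaw_pi_of_tendsto_eLpNorm`).
[cite: Janson1997, Ch. 1 (a closed linear span of Gaussian variables in L² is Gaussian)] -/
theorem isGaussianProcess_space (I : Submodule ℝ V) :
    IsGaussianProcess (fun (x : h.space I) (ω : Ω) => ((x : Lp ℝ 2 μ) : Ω → ℝ) ω) μ := by
  haveI := h.isProbabilityMeasure
  refine ⟨fun s => ?_⟩
  classical
  -- approximating test vectors for each element of `s`
  have happrox : ∀ x : s, ∃ v : ℕ → V, (∀ n, v n ∈ I) ∧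
      Tendsto (fun n => h.toL2 (v n)) atTop (𝓝 ((x : h.space I) : Lp ℝ 2 μ)) := fun x =>
    h.exists_seq_tendsto_of_mem_space (x : h.space I).2
  choose v _hvI hv using happrox
  have hGn : ∀ n, HasGaussianLaw (fun ω (i : s) => X (v i n) ω) μ := fun n => by
    have hg := (h.isGaussianProcess.comp_right fun i : s => v i n).hasGaussianLaw Finset.univ
    let L : ((↑(Finset.univ : Finset s) : Type _) → ℝ) →L[ℝ] (s → ℝ) :=
      { toFun := fun g i => g ⟨i, Finset.mem_univ i⟩
        map_add' := fun _ _ => rfl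
        map_smul' := fun _ _ => rfl
        cont := continuous_pi fun i => continuous_apply _ }
    exact hg.map L
  refine Literature.Probability.Distributions.hasGaussianLaw_pi_of_tendsto_eLpNorm hGn
    (fun i => ?_) (fun i => ?_)
  · exact Lp.memLp ((i : h.space I) : Lp ℝ 2 μ)
  · have ht := (Lp.tendsto_Lp_iff_tendsto_eLpNorm' _ _).1 (hv i)
    refine ht.congr fun n => eLpNorm_congr_ae ?_
    filter_upwards [h.coeFn_toL2 (v i n)] with ω hω
    simp only [Pi.sub_apply, hω, Finset.restrict]

/-! ### Orthogonal elements are independent of the generated σ-algebra -/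

/-- `⟪y, X v⟫_{L²} = E[y · X v]` for any `y ∈ L²`. [folklore] -/
theorem inner_toL2_right (y : Lp ℝ 2 μ) (v : V) : ⟪y, h.toL2 v⟫_ℝ = ∫ ω, y ω * X v ω ∂μ := by
  rw [MeasureTheory.L2.inner_def]
  refine integral_congr_ae ?_
  filter_upwards [h.coeFn_toL2 v] with ω hv
  rw [hv, RCLike.inner_apply, conj_trivial, mul_comm]

omit h in
/-- The σ-algebra generated by the vector-valued map `ω ↦ (X v ω)_{v ∈ I}` is `σ(X v : v ∈ I)`.
[folklore] -/
theorem comap_pi_eq_sigma (I : Submodule ℝ V) :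
    MeasurableSpace.comap (fun ω (v : I) => X v ω) MeasurableSpace.pi =
      IsGaussianLinearProcess.sigma (X := X) I := by
  rw [MeasurableSpace.pi, MeasurableSpace.comap_iSup]
  refine iSup_congr fun v => ?_
  rw [MeasurableSpace.comap_comp]
  rfl

/-- **An element of the Gaussian space orthogonal to all `X v`, `v ∈ I`, is independent of
`σ(X v : v ∈ I)`** — jointly Gaussian and uncorrelated variables are independent (Rozanov 1982,
Ch. 2 §3.1: conditional distributions of Gaussian variables given `H` are Gaussian with
conditional expectation `P(H)η`; Janson 1997, Ch. 1).  Proof: Mathlib's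
`IsGaussianProcess.indepFun_of_covariance_eq_zero` for the pair of processes `(x)` and
`(X v)_{v ∈ I}`, drawn from the jointly Gaussian process indexed by `H(⊤)`.
[cite: Rozanov1982, Ch. 2 §3.1 (3.3)] -/
theorem indep_comap_of_forall_inner_eq_zero (I : Submodule ℝ V) {x : Lp ℝ 2 μ}
    (hx : x ∈ h.space ⊤) (horth : ∀ v ∈ I, ⟪x, h.toL2 v⟫_ℝ = 0) :
    Indep (MeasurableSpace.comap (x : Ω → ℝ) (inferInstance : MeasurableSpace ℝ))
      (IsGaussianLinearProcess.sigma (X := X) I) μ := by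
  haveI := h.isProbabilityMeasure
  -- the pair of processes is jointly Gaussian: both are drawn from the process indexed by `H(⊤)`
  let g : Unit ⊕ I → h.space ⊤ :=
    Sum.elim (fun _ => ⟨x, hx⟩) (fun v => ⟨h.toL2 v, h.toL2_mem_space trivial⟩)
  have hG : IsGaussianProcess (Sum.elim (fun (_ : Unit) (ω : Ω) => x ω) (fun (v : I) ω => X v ω)) μ := by
    refine ((h.isGaussianProcess_space ⊤).comp_right g).congr fun t => ?_
    rcases t with u | v
    · exact Filter.EventuallyEq.rfl
    · exact h.coeFn_toL2 v
  have hcov : ∀ (u : Unit) (v : I), cov[(fun _ : Unit => (x : Ω → ℝ)) u, X v; μ] = 0 := by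
    intro u v
    rw [covariance_eq_sub (Lp.memLp x) (h.memLp v), h.centered v, mul_zero, sub_zero]
    have := horth v v.2
    rw [h.inner_toL2_right] at this
    simpa [Pi.mul_apply] using this
  have hind := IsGaussianProcess.indepFun_of_covariance_eq_zero hG
    (fun _ => (Lp.aestronglyMeasurable x).aemeasurable) (fun v => (h.measurable v).aemeasurable)
    hcov
  rw [IndepFun_iff_Indep] at hind
  have h1 : MeasurableSpace.comap (fun ω (_ : Unit) => (x : Ω → ℝ) ω) MeasurableSpace.pi =
      MeasurableSpace.comap (x : Ω → ℝ) (inferInstance : MeasurableSpace ℝ) := by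
    rw [MeasurableSpace.pi, MeasurableSpace.comap_iSup]
    have : ∀ i : Unit, MeasurableSpace.comap (fun ω (_ : Unit) => (x : Ω → ℝ) ω)
        (MeasurableSpace.comap (fun b : Unit → ℝ => b i) (inferInstance : MeasurableSpace ℝ)) =
        MeasurableSpace.comap (x : Ω → ℝ) (inferInstance : MeasurableSpace ℝ) := fun i => by
      rw [MeasurableSpace.comap_comp]; rfl
    simp only [this, ciSup_const]
  rwa [h1, comap_pi_eq_sigma] at hind

end IsGaussianLinearProcess

end Literature.Probability.Process
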